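import Mathlib

/-!
# `CliqueExtLowerBound` (stmt-PneNP-10682) — negative side: sign patterns of finitely many linear functionals

Standing-adversary (cdisprove, gen 3) tool for `FewRowsCount.lean` / `FewRows.lean` ("a CONV gate with few
constraint ROWS cannot compute CLIQUE, whatever its psd dimension").

`card_signPatterns_le` / `card_signPatterns_le'`: `N` linear functionals on a real vector space of dimension
`d` realise at most `(N+1)^d` patterns `(0 ≤ gⱼ y)ⱼ ∈ {0,1}^N` (regions of a CENTRAL hyperplane
arrangement, degenerate positions allowed). Proof: restrict to the first `N` functionals; a restricted
pattern with both extensions is realised on the hyperplane `ker g_N` (convexity of the two realising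
regions), whose dimension is `d - 1`; so `Φ(N+1, d) ≤ Φ(N, d) + Φ(N, d-1)` and `Φ(N, d) ≤ (N+1)^d`.
Refuter seat cdisprove-stmt-PneNP-10682-g3, 2026-08-16.
-/

namespace Summit.PneNP.PneNP.Theorems.CliqueExtLowerBound.Negative

open Finset Module

section SignPatterns

variable {V : Type*} [AddCommGroup V] [Module ℝ V]

open Classical in
/-- The realisable sign patterns `(decide (0 ≤ gⱼ y))ⱼ` of a tuple of linear functionals. [folklore] -/
noncomputable def signPatterns {N : ℕ} (g : Fin N → V →ₗ[ℝ] ℝ) : Finset (Fin N → Bool) :=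
  univ.filter fun σ => ∃ y : V, ∀ j, σ j = decide (0 ≤ g j y)

open Classical in
/-- Membership in `signPatterns`. [folklore] -/
theorem mem_signPatterns {N : ℕ} (g : Fin N → V →ₗ[ℝ] ℝ) (σ : Fin N → Bool) :
    σ ∈ signPatterns g ↔ ∃ y : V, ∀ j, σ j = decide (0 ≤ g j y) := by
  simp [signPatterns]

/-- **Region count for central arrangements.** `N` linear functionals on a real vector space of
dimension `d` realise at most `(N+1)^d` sign patterns. [folklore] -/
theorem card_signPatterns_le [FiniteDimensional ℝ V] :
    ∀ (N : ℕ) (g : Fin N → V →ₗ[ℝ] ℝ), #(signPatterns g) ≤ (N + 1) ^ finrank ℝ V := by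
  classical
  intro N
  induction N generalizing V with
  | zero =>
    intro g
    calc #(signPatterns g) ≤ #(univ : Finset (Fin 0 → Bool)) := card_le_univ _
      _ = 1 := by simp
      _ = (0 + 1) ^ finrank ℝ V := by simp
  | succ N ih =>
    intro g
    set g' : Fin N → V →ₗ[ℝ] ℝ := fun j => g (Fin.castSucc j) with hg'
    set gl : V →ₗ[ℝ] ℝ := g (Fin.last N) with hgl
    -- restriction of patterns
    set ρ : (Fin (N + 1) → Bool) → (Fin N → Bool) := fun σ j => σ (Fin.castSucc j) with hρ
    set P := signPatterns g with hP
    set P₁ := P.filter fun σ => σ (Fin.last N) = true with hP₁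
    set P₀ := P.filter fun σ => σ (Fin.last N) = false with hP₀
    have hsplit : #P = #P₁ + #P₀ := by
      rw [hP₁, hP₀, ← Finset.card_filter_add_card_filter_not (fun σ => σ (Fin.last N) = true)]
      congr 2
      ext σ
      simp
    -- `ρ` is injective on each half
    have hinj : ∀ b : Bool, Set.InjOn ρ ↑(P.filter fun σ => σ (Fin.last N) = b) := by
      intro b σ hσ τ hτ hστ
      rw [Finset.coe_filter] at hσ hτ
      funext j
      rcases Fin.eq_castSucc_or_eq_last j with ⟨j', rfl⟩ | rfl
      · exact congrFun hστ j'
      · rw [hσ.2, hτ.2]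
    -- images lie in the patterns of `g'`
    have himg : ∀ b : Bool, (P.filter fun σ => σ (Fin.last N) = b).image ρ ⊆ signPatterns g' := by
      intro b τ hτ
      obtain ⟨σ, hσ, rfl⟩ := Finset.mem_image.1 hτ
      obtain ⟨y, hy⟩ := (mem_signPatterns g σ).1 (Finset.mem_filter.1 hσ).1
      exact (mem_signPatterns g' _).2 ⟨y, fun j => hy (Fin.castSucc j)⟩
    -- the doubly-extendable patterns are realised on the hyperplane `ker gl`
    set H := LinearMap.ker gl with hH
    set gH : Fin N → H →ₗ[ℝ] ℝ := fun j => (g' j).comp H.subtype with hgH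
    have hboth : (P₁.image ρ ∩ P₀.image ρ) ⊆ signPatterns gH := by
      intro τ hτ
      rw [Finset.mem_inter] at hτ
      obtain ⟨σ₁, hσ₁, h₁⟩ := Finset.mem_image.1 hτ.1
      obtain ⟨σ₀, hσ₀, h₀⟩ := Finset.mem_image.1 hτ.2
      obtain ⟨hσ₁P, hσ₁l⟩ := Finset.mem_filter.1 hσ₁
      obtain ⟨hσ₀P, hσ₀l⟩ := Finset.mem_filter.1 hσ₀
      obtain ⟨y₁, hy₁⟩ := (mem_signPatterns g σ₁).1 hσ₁P
      obtain ⟨y₀, hy₀⟩ := (mem_signPatterns g σ₀).1 hσ₀P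
      have ha : 0 ≤ gl y₁ := by
        have := hy₁ (Fin.last N); rw [hσ₁l] at this
        exact of_decide_eq_true this.symm
      have hb : gl y₀ < 0 := by
        have := hy₀ (Fin.last N); rw [hσ₀l] at this
        exact not_le.1 (of_decide_eq_false this.symm)
      set a := gl y₁ with ha'
      set b := - gl y₀ with hb'
      have hb0 : 0 < b := by rw [hb']; linarith
      have hab : 0 < a + b := by linarith
      set z : V := (b / (a + b)) • y₁ + (a / (a + b)) • y₀ with hz
      have hzH : z ∈ H := by
        rw [hH, LinearMap.mem_ker, hz, map_add, map_smul, map_smul, smul_eq_mul, smul_eq_mul]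
        rw [← ha', show gl y₀ = -b by rw [hb']; ring]
        field_simp
        ring
      refine (mem_signPatterns gH τ).2 ⟨⟨z, hzH⟩, fun j => ?_⟩
      have hj₁ : τ j = decide (0 ≤ g' j y₁) := by rw [← h₁]; exact hy₁ (Fin.castSucc j)
      have hj₀ : τ j = decide (0 ≤ g' j y₀) := by rw [← h₀]; exact hy₀ (Fin.castSucc j)
      have hval : gH j ⟨z, hzH⟩ = (b / (a + b)) * g' j y₁ + (a / (a + b)) * g' j y₀ := by
        simp [hgH, hz]
      have hc1 : 0 < b / (a + b) := div_pos hb0 hab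
      have hc0 : 0 ≤ a / (a + b) := div_nonneg ha hab.le
      rw [hval]
      cases hτj : τ j
      · rw [hτj] at hj₁ hj₀
        have h1 : g' j y₁ < 0 := not_le.1 (of_decide_eq_false hj₁.symm)
        have h0 : g' j y₀ < 0 := not_le.1 (of_decide_eq_false hj₀.symm)
        symm
        rw [decide_eq_false_iff_not, not_le]
        have : a / (a + b) * g' j y₀ ≤ 0 := mul_nonpos_of_nonneg_of_nonpos hc0 h0.le
        nlinarith
      · rw [hτj] at hj₁ hj₀
        have h1 : 0 ≤ g' j y₁ := of_decide_eq_true hj₁.symm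
        have h0 : 0 ≤ g' j y₀ := of_decide_eq_true hj₀.symm
        symm
        rw [decide_eq_true_iff]
        positivity
    -- counting
    have hcard : #P ≤ #(signPatterns g') + #(signPatterns gH) := by
      rw [hsplit, ← Finset.card_image_of_injOn (hinj true), ← Finset.card_image_of_injOn (hinj false),
        ← Finset.card_union_add_card_inter]
      exact Nat.add_le_add (Finset.card_le_card (Finset.union_subset (himg true) (himg false)))
        (Finset.card_le_card hboth)
    have ih1 := ih g'
    by_cases hgl0 : gl = 0
    · -- only one extension: the intersection is empty, as no pattern has `false` last
      have hP₀e : P₀ = ∅ := by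
        rw [hP₀, Finset.filter_eq_empty_iff]
        intro σ hσ hl
        obtain ⟨y, hy⟩ := (mem_signPatterns g σ).1 hσ
        have := hy (Fin.last N)
        rw [hl, ← hgl, hgl0] at this
        simp at this
      have : #P ≤ #(signPatterns g') := by
        rw [hsplit, hP₀e, Finset.card_empty, add_zero, ← Finset.card_image_of_injOn (hinj true)]
        exact Finset.card_le_card (himg true)
      calc #P ≤ (N + 1) ^ finrank ℝ V := this.trans ih1
        _ ≤ (N + 1 + 1) ^ finrank ℝ V := Nat.pow_le_pow_left (by omega) _
    · -- `dim ker gl = d - 1`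
      have hrange : finrank ℝ (LinearMap.range gl) = 1 := by
        have h1 : finrank ℝ (LinearMap.range gl) ≤ 1 :=
          (Submodule.finrank_le _).trans (by simp)
        have h2 : 0 < finrank ℝ (LinearMap.range gl) := by
          rw [Module.finrank_pos_iff_exists_ne_zero]
          obtain ⟨v, hv⟩ : ∃ v, gl v ≠ 0 := by
            by_contra h
            push Not at h
            exact hgl0 (LinearMap.ext h)
          exact ⟨⟨gl v, LinearMap.mem_range_self gl v⟩, fun h => hv (congrArg Subtype.val h)⟩
        omega
      have hdim : finrank ℝ H + 1 = finrank ℝ V := by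
        have := LinearMap.finrank_range_add_finrank_ker gl
        rw [hrange] at this
        rw [hH]; omega
      have ihH := ih gH
      set d := finrank ℝ V with hd
      have hd1 : finrank ℝ H = d - 1 := by omega
      have hdpos : 1 ≤ d := by omega
      -- `(x+1)^(n+1) ≥ x^(n+1) + x^n`
      have key : ∀ x n : ℕ, x ^ (n + 1) + x ^ n ≤ (x + 1) ^ (n + 1) := by
        intro x n
        rw [pow_succ, pow_succ]
        have hx : x ^ n ≤ (x + 1) ^ n := Nat.pow_le_pow_left (by omega) _
        nlinarith
      calc #P ≤ (N + 1) ^ d + (N + 1) ^ (d - 1) := by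
            rw [hd1] at ihH; exact hcard.trans (Nat.add_le_add ih1 ihH)
        _ = (N + 1) ^ (d - 1 + 1) + (N + 1) ^ (d - 1) := by rw [Nat.sub_add_cancel hdpos]
        _ ≤ (N + 1 + 1) ^ (d - 1 + 1) := key (N + 1) (d - 1)
        _ = (N + 1 + 1) ^ d := by rw [Nat.sub_add_cancel hdpos]

open Classical in
/-- Realisable sign patterns of a finite family of linear functionals (arbitrary finite index type).
[folklore] -/
noncomputable def signPatterns' {ι : Type*} [Fintype ι] (g : ι → V →ₗ[ℝ] ℝ) : Finset (ι → Bool) :=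
  univ.filter fun σ => ∃ y : V, ∀ i, σ i = decide (0 ≤ g i y)

open Classical in
/-- Membership in `signPatterns'`. [folklore] -/
theorem mem_signPatterns' {ι : Type*} [Fintype ι] (g : ι → V →ₗ[ℝ] ℝ) (σ : ι → Bool) :
    σ ∈ signPatterns' g ↔ ∃ y : V, ∀ i, σ i = decide (0 ≤ g i y) := by
  simp [signPatterns']

/-- **Region count, arbitrary finite index type**: at most `(#ι + 1)^d` sign patterns. [folklore] -/
theorem card_signPatterns_le' [FiniteDimensional ℝ V] {ι : Type*} [Fintype ι] (g : ι → V →ₗ[ℝ] ℝ) :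
    #(signPatterns' g) ≤ (Fintype.card ι + 1) ^ finrank ℝ V := by
  classical
  set e := Fintype.equivFin ι with he
  set g₀ : Fin (Fintype.card ι) → V →ₗ[ℝ] ℝ := fun j => g (e.symm j) with hg₀
  have hmap : (signPatterns' g).image (fun σ : ι → Bool => fun j => σ (e.symm j)) ⊆ signPatterns g₀ := by
    intro τ hτ
    obtain ⟨σ, hσ, rfl⟩ := Finset.mem_image.1 hτ
    obtain ⟨y, hy⟩ := (mem_signPatterns' g σ).1 hσ
    exact (mem_signPatterns g₀ _).2 ⟨y, fun j => hy (e.symm j)⟩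
  have hinj : Set.InjOn (fun σ : ι → Bool => fun j => σ (e.symm j)) ↑(signPatterns' g) := by
    intro σ _ τ _ hστ
    funext i
    have := congrFun hστ (e i)
    simpa using this
  calc #(signPatterns' g) = #((signPatterns' g).image fun σ : ι → Bool => fun j => σ (e.symm j)) :=
        (Finset.card_image_of_injOn hinj).symm
    _ ≤ #(signPatterns g₀) := Finset.card_le_card hmap
    _ ≤ (Fintype.card ι + 1) ^ finrank ℝ V := card_signPatterns_le _ g₀

end SignPatterns

end Summit.PneNP.PneNP.Theorems.CliqueExtLowerBound.Negative
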